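import Mathlib
import Literature.Probability.LatticeModels.CriticalScalingDimension
import HarnessLib

/-!
# The two-point kernel of a pointwise scaling limit of the critical `ℤ³` Ising correlators

Helper file for item stmt-CriticalPhenomena-1983 (`TwoPointKernelOfLimit`, routes
`GaussianScaleMixture` / `HyperoctahedralRP` of `CriticalPhenomena/Ising3DConformalLimit`).

For a pointwise scaling limit `S` of `criticalCorr 3` (`HasPointwiseScalingLimit`) we derive, for
the kernel `K y := S 2 ![0, y]`, the lattice symmetries and the Messager–Miracle-Solé
monotonicities IN THE LIMIT:

* `tendsto_kernel` — `ρ(δ)² ⟨σ₀ σ_{[y/δ]}⟩_{β_c} → K y` as `δ → 0⁺`, `y ≠ 0`;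
* `kernel_reflect` — `K (y - 2yᵢ eᵢ) = K y` (coordinate reflections);
* `kernel_perm` — `K (y ∘ π) = K y` (coordinate permutations);
* `kernel_axis_mono` — `K (y + t eᵢ) ≤ K y` for `yᵢ ≥ 0`, `t ≥ 0`, `y ≠ 0`;
* `kernel_diag_mono` — `K (y + t (eᵢ - eⱼ)) ≤ K y` for `yⱼ ≤ yᵢ`, `t ≥ 0`, `y ≠ 0`;
* `kernel_smul` — `K (c • y) = c^{-2Δ} K y` from scale covariance.

The limit statements use the SPECIAL MESHES `δ_m = t/(m+1)`, along which the lattice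
approximation `[·/δ_m]` of `y + t v` (`v ∈ ℤ³`) is EXACTLY `[y/δ_m] + (m+1) v`, so that the
lattice inequalities (`messager_miracleSole_holds`, `messager_miracleSole_diag_holds`, iterated)
and symmetries (`twoPointPlus_reflection_invariant_holds`, `twoPointPlus_perm_invariant_holds`)
transfer termwise; no continuity of `K` is needed at this stage.

References: A. Messager, S. Miracle-Solé, J. Stat. Phys. 17 (1977) 245–262; G. C. Hegerfeldt,
Comm. Math. Phys. 57 (1977) 259–266; S. Friedli, Y. Velenik, *Statistical Mechanics of Lattice
Systems* (CUP 2017), Exercise 3.14, §3.10.6.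
-/

noncomputable section

open Filter Topology
open Literature.Probability.LatticeModels

namespace Summit.CriticalPhenomena.Ising3DConformalLimit.Theorems.TwoPointKernel

local notation "E3" => EuclideanSpace ℝ (Fin 3)

variable {ρ : ℝ → ℝ} {S : CorrFamily 3}

/-! ### Pointwise convergence of the rescaled two-point function -/

/-- `(0, y)` is a non-coincident pair for `y ≠ 0`. -/
theorem zero_pair_mem_nonCoincident {y : E3} (hy : y ≠ 0) :
    (![0, y] : Fin 2 → E3) ∈ NonCoincident 3 2 := by
  rw [mem_nonCoincident]
  intro i j hij
  fin_cases i <;> fin_cases j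
  · rfl
  · exact absurd hij.symm hy
  · exact absurd hij hy
  · rfl

/-- `[0/δ] = 0`. -/
theorem latticeApprox_zero' (δ : ℝ) : latticeApprox δ (0 : E3) = 0 := by
  funext k; simp [latticeApprox_apply]

/-- The lattice configuration of the pair `(0, y)` at mesh `δ` is `(0, [y/δ])`. -/
theorem latticeApprox_zero_pair (δ : ℝ) (y : E3) :
    (fun i => latticeApprox δ ((![0, y] : Fin 2 → E3) i)) = ![0, latticeApprox δ y] := by
  funext i
  fin_cases i
  · simp [latticeApprox_zero']
  · rfl

/-- **Pointwise convergence**: `ρ(δ)² ⟨σ₀ σ_{[y/δ]}⟩_{β_c} → S₂(0, y)` as `δ → 0⁺`, for `y ≠ 0`. -/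
theorem tendsto_kernel (hlim : HasPointwiseScalingLimit (criticalCorr 3) ρ S) {y : E3}
    (hy : y ≠ 0) :
    Tendsto (fun δ => ρ δ ^ 2 * criticalTwoPoint 3 (latticeApprox δ y)) (𝓝[>] 0)
      (𝓝 (S 2 ![0, y])) := by
  refine ((hlim 2).tendsto_at (zero_pair_mem_nonCoincident hy)).congr fun δ => ?_
  rw [rescaledCorrelator_apply, latticeApprox_zero_pair, criticalCorr_two]

/-- The special meshes `δ_m = t/(m+1) → 0⁺`. -/
theorem tendsto_mesh {t : ℝ} (ht : 0 < t) :
    Tendsto (fun m : ℕ => t / ((m : ℝ) + 1)) atTop (𝓝[>] 0) := by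
  rw [tendsto_nhdsWithin_iff]
  refine ⟨?_, Filter.Eventually.of_forall fun m => ?_⟩
  · exact ((tendsto_const_div_atTop_nhds_zero_nat t).comp (tendsto_add_atTop_nat 1)).congr
      fun m => by simp
  · exact div_pos ht (by positivity)

/-- Pointwise convergence along the special meshes. -/
theorem tendsto_kernel_mesh (hlim : HasPointwiseScalingLimit (criticalCorr 3) ρ S) {y : E3}
    (hy : y ≠ 0) {t : ℝ} (ht : 0 < t) :
    Tendsto (fun m : ℕ => ρ (t / ((m : ℝ) + 1)) ^ 2 *
      criticalTwoPoint 3 (latticeApprox (t / ((m : ℝ) + 1)) y)) atTop (𝓝 (S 2 ![0, y])) :=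
  (tendsto_kernel hlim hy).comp (tendsto_mesh ht)

/-- **Exactness of the special meshes**: `[(y + t v)/δ_m] = [y/δ_m] + (m+1) v` for `v ∈ ℤ³`,
`δ_m = t/(m+1)`. -/
theorem latticeApprox_mesh_add {t : ℝ} (ht : 0 < t) (m : ℕ) (y : E3) (v : Site 3) :
    latticeApprox (t / ((m : ℝ) + 1)) (y + t • WithLp.toLp 2 fun k => (v k : ℝ)) =
      latticeApprox (t / ((m : ℝ) + 1)) y + ((m : ℤ) + 1) • v := by
  funext k
  simp only [latticeApprox_apply, PiLp.add_apply, PiLp.smul_apply, smul_eq_mul, Pi.add_apply,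
    Pi.smul_apply]
  have hm : (0 : ℝ) < (m : ℝ) + 1 := by positivity
  have h1 : (y k + t * (v k : ℝ)) / (t / ((m : ℝ) + 1)) =
      y k / (t / ((m : ℝ) + 1)) + ((((m : ℤ) + 1) * v k : ℤ) : ℝ) := by
    push_cast
    field_simp
  rw [h1, Int.floor_add_intCast]

/-! ### Lattice symmetries in the limit -/

/-- A coordinate reflection of `ℝ³` does not create zeros. -/
theorem reflect_ne_zero {y : E3} (hy : y ≠ 0) (i : Fin 3) :
    y - (2 * y i) • EuclideanSpace.single i (1:ℝ) ≠ 0 := by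
  intro h
  apply hy
  ext k
  have hk := congrArg (fun v : E3 => v k) h
  by_cases hki : k = i
  · subst hki
    simp only [PiLp.sub_apply, PiLp.smul_apply, PiLp.single_apply, if_true, smul_eq_mul,
      mul_one, PiLp.zero_apply] at hk ⊢
    linarith
  · simpa [hki] using hk

/-- **Coordinate reflections**: `S₂(0, y - 2yᵢeᵢ) = S₂(0, y)` (lattice reflection invariance
`twoPointPlus_reflection_invariant_holds` along the meshes `|yᵢ|/(m+1)`, on which `yᵢ/δ ∈ ℤ` and the
floor commutes with negation). -/
theorem kernel_reflect (hlim : HasPointwiseScalingLimit (criticalCorr 3) ρ S) (y : E3)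
    (i : Fin 3) :
    S 2 ![0, y - (2 * y i) • EuclideanSpace.single i (1:ℝ)] = S 2 ![0, y] := by
  by_cases hyi : y i = 0
  · rw [hyi, mul_zero, zero_smul, sub_zero]
  have hy : y ≠ 0 := fun h => hyi (by rw [h]; rfl)
  have ht : 0 < |y i| := abs_pos.2 hyi
  refine tendsto_nhds_unique (tendsto_kernel_mesh hlim (reflect_ne_zero hy i) ht) ?_
  refine (tendsto_kernel_mesh hlim hy ht).congr fun m => ?_
  -- the two lattice points are mirror images
  set δ : ℝ := |y i| / ((m : ℝ) + 1) with hδ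
  have hm : (0 : ℝ) < (m : ℝ) + 1 := by positivity
  have hδ0 : 0 < δ := div_pos ht hm
  -- `y i / δ` is an integer `n`
  obtain ⟨n, hn⟩ : ∃ n : ℤ, y i / δ = n := by
    rcases lt_or_gt_of_ne hyi with h | h
    · refine ⟨-((m : ℤ) + 1), ?_⟩
      rw [hδ, abs_of_neg h]
      have hyk : y i ≠ 0 := hyi
      push_cast
      field_simp
    · refine ⟨(m : ℤ) + 1, ?_⟩
      rw [hδ, abs_of_pos h]
      have hyk : y i ≠ 0 := hyi
      push_cast
      field_simp
  have key : latticeApprox δ (y - (2 * y i) • EuclideanSpace.single i (1:ℝ)) =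
      Function.update (latticeApprox δ y) i (-(latticeApprox δ y i)) := by
    funext k
    by_cases hki : k = i
    · subst hki
      simp only [latticeApprox_apply, Function.update_self, PiLp.sub_apply, PiLp.smul_apply,
        PiLp.single_apply, if_true, smul_eq_mul, mul_one]
      have : (y k - 2 * y k) / δ = -(y k / δ) := by ring
      rw [this, hn, Int.floor_intCast, ← Int.cast_neg, Int.floor_intCast]
    · simp [latticeApprox_apply, hki]
  rw [key]
  congr 1
  exact (twoPointPlus_reflection_invariant_holds (criticalBeta_nonneg 3) i _).symm

/-- **Coordinate permutations**: `S₂(0, y ∘ π) = S₂(0, y)` (the floor commutes with permutations,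
`twoPointPlus_perm_invariant_holds`). -/
theorem kernel_perm (hlim : HasPointwiseScalingLimit (criticalCorr 3) ρ S) (π : Equiv.Perm (Fin 3))
    (y : E3) : S 2 ![0, WithLp.toLp 2 fun k => y (π k)] = S 2 ![0, y] := by
  by_cases hy : y = 0
  · subst hy
    have h0 : (WithLp.toLp 2 fun k => (0 : E3) (π k) : E3) = 0 := by
      ext k; simp
    rw [h0]
  have hy' : (WithLp.toLp 2 fun k => y (π k) : E3) ≠ 0 := by
    intro h
    apply hy
    ext k
    have := congrArg (fun v : E3 => v (π.symm k)) h
    simpa using this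
  refine tendsto_nhds_unique (tendsto_kernel hlim hy') ((tendsto_kernel hlim hy).congr fun δ => ?_)
  have key : latticeApprox δ (WithLp.toLp 2 fun k => y (π k)) = fun k => latticeApprox δ y (π k) := by
    funext k; simp [latticeApprox_apply]
  rw [key]
  congr 1
  exact (twoPointPlus_perm_invariant_holds (criticalBeta_nonneg 3) π _).symm

/-! ### Messager–Miracle-Solé in the limit -/

/-- Iterated axis Messager–Miracle-Solé: `⟨σ₀σ_{L + k eᵢ}⟩ ≤ ⟨σ₀σ_L⟩` for `Lᵢ ≥ 0`, `k ∈ ℕ`. -/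
theorem twoPointPlus_add_single_le' (L : Site 3) (i : Fin 3) (hL : 0 ≤ L i) (k : ℕ) :
    twoPointPlus 3 (criticalBeta 3) (L + Pi.single i (k : ℤ)) ≤ twoPointPlus 3 (criticalBeta 3) L :=
  twoPointPlus_add_single_le (messager_miracleSole_holds (d := 3) (β := criticalBeta 3))
    (criticalBeta_nonneg 3) L i hL k

/-- Iterated diagonal Messager–Miracle-Solé: `⟨σ₀σ_{L + k(eᵢ - eⱼ)}⟩ ≤ ⟨σ₀σ_L⟩` for `Lⱼ ≤ Lᵢ`. -/
theorem twoPointPlus_add_sub_single_le (L : Site 3) {i j : Fin 3} (hij : i ≠ j)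
    (hL : L j ≤ L i) (k : ℕ) :
    twoPointPlus 3 (criticalBeta 3) (L + Pi.single i (k : ℤ) - Pi.single j (k : ℤ)) ≤
      twoPointPlus 3 (criticalBeta 3) L := by
  induction k with
  | zero =>
    have h0 : L + Pi.single i ((0 : ℕ) : ℤ) - Pi.single j ((0 : ℕ) : ℤ) = L := by simp
    rw [h0]
  | succ k ih =>
    have h := messager_miracleSole_diag_holds (d := 3) (β := criticalBeta 3) (criticalBeta_nonneg 3)
      (L + Pi.single i (k : ℤ) - Pi.single j (k : ℤ)) hij (by
        simp only [Pi.add_apply, Pi.sub_apply, Pi.single_eq_same, Pi.single_eq_of_ne hij,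
          Pi.single_eq_of_ne hij.symm]
        omega)
    have hstep : L + Pi.single i (k : ℤ) - Pi.single j (k : ℤ) + Pi.single i 1 - Pi.single j 1 =
        L + Pi.single i (((k + 1 : ℕ) : ℤ)) - Pi.single j (((k + 1 : ℕ) : ℤ)) := by
      simp only [Nat.cast_succ, Pi.single_add]
      abel
    rw [hstep] at h
    exact h.trans ih

/-- `eᵢ` as the image of the lattice vector `Pi.single i 1`. -/
theorem single_eq_toLp_intCast (i : Fin 3) :
    (EuclideanSpace.single i (1:ℝ) : E3) =
      WithLp.toLp 2 fun k => ((Pi.single i (1:ℤ) : Site 3) k : ℝ) := by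
  ext k
  by_cases hk : k = i
  · subst hk; simp
  · simp [hk]

/-- `eᵢ - eⱼ` as the image of the lattice vector `Pi.single i 1 - Pi.single j 1`. -/
theorem single_sub_single_eq_toLp_intCast (i j : Fin 3) :
    (EuclideanSpace.single i (1:ℝ) - EuclideanSpace.single j (1:ℝ) : E3) =
      WithLp.toLp 2 fun k => ((Pi.single i (1:ℤ) - Pi.single j (1:ℤ) : Site 3) k : ℝ) := by
  rw [single_eq_toLp_intCast i, single_eq_toLp_intCast j]
  ext k
  simp only [PiLp.sub_apply, Pi.sub_apply, Int.cast_sub]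

/-- An axis move away from the mirror does not create zeros. -/
theorem add_smul_single_ne_zero {y : E3} (hy : y ≠ 0) {i : Fin 3} (hyi : 0 ≤ y i) {t : ℝ}
    (ht : 0 ≤ t) : y + t • EuclideanSpace.single i (1:ℝ) ≠ 0 := by
  intro h
  apply hy
  ext k
  have hk := congrArg (fun v : E3 => v k) h
  by_cases hki : k = i
  · subst hki
    simp only [PiLp.add_apply, PiLp.smul_apply, PiLp.single_apply, if_true, smul_eq_mul, mul_one,
      PiLp.zero_apply] at hk ⊢
    linarith
  · simpa [hki] using hk

/-- A diagonal move away from the mirror does not create zeros. -/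
theorem add_smul_single_sub_ne_zero {y : E3} (hy : y ≠ 0) {i j : Fin 3} (hij : i ≠ j)
    (hyij : y j ≤ y i) {t : ℝ} (ht : 0 ≤ t) :
    y + t • (EuclideanSpace.single i (1:ℝ) - EuclideanSpace.single j (1:ℝ)) ≠ 0 := by
  intro h
  apply hy
  have hi := congrArg (fun v : E3 => v i) h
  have hj := congrArg (fun v : E3 => v j) h
  simp only [PiLp.add_apply, PiLp.smul_apply, PiLp.sub_apply, PiLp.single_apply, if_true,
    if_neg hij, if_neg hij.symm, smul_eq_mul, PiLp.zero_apply] at hi hj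
  have ht0 : t = 0 := by linarith
  rw [ht0, zero_smul, add_zero] at h
  exact h

/-- **Axis monotonicity of the limit kernel** (Messager–Miracle-Solé / Hegerfeldt Thm. 3.1 in the
limit): `S₂(0, y + t eᵢ) ≤ S₂(0, y)` for `y ≠ 0`, `yᵢ ≥ 0`, `t ≥ 0`. -/
theorem kernel_axis_mono (hlim : HasPointwiseScalingLimit (criticalCorr 3) ρ S) {y : E3}
    (hy : y ≠ 0) (i : Fin 3) (hyi : 0 ≤ y i) (t : ℝ) (ht : 0 ≤ t) :
    S 2 ![0, y + t • EuclideanSpace.single i (1:ℝ)] ≤ S 2 ![0, y] := by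
  rcases ht.eq_or_lt with rfl | ht0
  · simp
  refine le_of_tendsto_of_tendsto' (tendsto_kernel_mesh hlim (add_smul_single_ne_zero hy hyi ht) ht0)
    (tendsto_kernel_mesh hlim hy ht0) fun m => ?_
  refine mul_le_mul_of_nonneg_left ?_ (sq_nonneg _)
  unfold criticalTwoPoint
  rw [single_eq_toLp_intCast, latticeApprox_mesh_add ht0]
  have hk : ((m : ℤ) + 1) • (Pi.single i (1:ℤ) : Site 3) = Pi.single i (((m + 1 : ℕ) : ℤ)) := by
    rw [← Pi.single_smul]; push_cast; simp
  rw [hk]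
  refine twoPointPlus_add_single_le' _ i ?_ (m + 1)
  rw [latticeApprox_apply]
  exact Int.floor_nonneg.2 (div_nonneg hyi (div_pos ht0 (by positivity)).le)

/-- **Diagonal monotonicity of the limit kernel** (Hegerfeldt Thm. 3.2 in the limit):
`S₂(0, y + t (eᵢ - eⱼ)) ≤ S₂(0, y)` for `y ≠ 0`, `i ≠ j`, `yⱼ ≤ yᵢ`, `t ≥ 0`. -/
theorem kernel_diag_mono (hlim : HasPointwiseScalingLimit (criticalCorr 3) ρ S) {y : E3}
    (hy : y ≠ 0) {i j : Fin 3} (hij : i ≠ j) (hyij : y j ≤ y i) (t : ℝ) (ht : 0 ≤ t) :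
    S 2 ![0, y + t • (EuclideanSpace.single i (1:ℝ) - EuclideanSpace.single j (1:ℝ))] ≤
      S 2 ![0, y] := by
  rcases ht.eq_or_lt with rfl | ht0
  · simp
  refine le_of_tendsto_of_tendsto'
    (tendsto_kernel_mesh hlim (add_smul_single_sub_ne_zero hy hij hyij ht) ht0)
    (tendsto_kernel_mesh hlim hy ht0) fun m => ?_
  refine mul_le_mul_of_nonneg_left ?_ (sq_nonneg _)
  unfold criticalTwoPoint
  rw [single_sub_single_eq_toLp_intCast, latticeApprox_mesh_add ht0]
  have hk : ((m : ℤ) + 1) • (Pi.single i (1:ℤ) - Pi.single j (1:ℤ) : Site 3) =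
      Pi.single i (((m + 1 : ℕ) : ℤ)) - Pi.single j (((m + 1 : ℕ) : ℤ)) := by
    rw [smul_sub, ← Pi.single_smul, ← Pi.single_smul]; push_cast; simp
  rw [hk, ← add_sub_assoc]
  refine twoPointPlus_add_sub_single_le _ hij ?_ (m + 1)
  simp only [latticeApprox_apply]
  exact Int.floor_le_floor (div_le_div_of_nonneg_right hyij (div_pos ht0 (by positivity)).le)

/-! ### Scale covariance at `n = 2` -/

/-- **Homogeneity of the kernel**: `S₂(0, c • y) = c^{-2Δ} S₂(0, y)` for `c > 0`. -/
theorem kernel_smul {Δ : ℝ} (hsc : IsScaleCovariant Δ S) {c : ℝ} (hc : 0 < c) (y : E3) :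
    S 2 ![0, c • y] = c ^ (-(2 * Δ)) * S 2 ![0, y] := by
  have h := hsc 2 c hc ![0, y]
  have hcfg : (fun i => c • (![0, y] : Fin 2 → E3) i) = ![0, c • y] := by
    funext i; fin_cases i <;> simp
  rw [hcfg] at h
  rw [h]
  norm_num [neg_mul]

/-- Continuity of the kernel along rays: `c ↦ S₂(0, c • x)` is continuous at `c = 1`. -/
theorem tendsto_kernel_smul {Δ : ℝ} (hsc : IsScaleCovariant Δ S) (x : E3) :
    Tendsto (fun c : ℝ => S 2 ![0, c • x]) (𝓝 1) (𝓝 (S 2 ![0, x])) := by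
  have hev : (fun c : ℝ => c ^ (-(2 * Δ)) * S 2 ![0, x]) =ᶠ[𝓝 1] fun c => S 2 ![0, c • x] := by
    filter_upwards [Ioi_mem_nhds one_pos] with c hc
    rw [kernel_smul hsc hc]
  refine Tendsto.congr' hev ?_
  have h1 : Tendsto (fun c : ℝ => c ^ (-(2 * Δ))) (𝓝 1) (𝓝 1) := by
    have := (Real.continuousAt_rpow_const 1 (-(2 * Δ)) (Or.inl one_ne_zero)).tendsto
    simpa using this
  simpa using h1.mul_const (S 2 ![0, x])

end Summit.CriticalPhenomena.Ising3DConformalLimit.Theorems.TwoPointKernel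

end
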